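import Literature.NumberTheory.GaloisRepresentations.NearlyOrdinaryTangentSpace
import Literature.NumberTheory.GaloisRepresentations.DeformationLiftingObstruction
import HarnessLib

/-!
# From a lift of `ρ_𝒟 mod 𝔪ⁿ` to a section of a small extension (universality)

Topic `Literature/NumberTheory/GaloisRepresentations`.  The last, purely deformation-theoretic
step of Mazur's relation count for the nearly ordinary deformation ring `R_𝒟`
([Maz89, §1.6 Prop. 2]; [Böc07, Thm. 2.4/Thm. 7.6], "universality of `𝓡` gives the section"):
for an object `B` of `Ĉ_𝒪(k)` and an `𝒪`-algebra map `q : B → R_𝒟/𝔪ⁿ` (`n ≥ 1`),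

* `isDeformation_map` — `φ ∘ ρ_𝒟` is a deformation of type `𝒟` for every morphism
  `φ : R_𝒟 → B` of `Ĉ_𝒪(k)` (in particular `ρ_𝒟 mod 𝔪ⁿ`, `isDeformation_modPow`), and
  `eq_mkₐ_of_isStrictEquiv` — the only `ψ : R_𝒟 → R_𝒟/𝔪ⁿ` with `ψ ∘ ρ_𝒟` strictly equivalent to
  `ρ_𝒟 mod 𝔪ⁿ` is the quotient map (uniqueness half of universality);
* `isDeformation_of_lift` — a homomorphism `ρ_B : Γ_F → GL₂(B)` with `q ∘ ρ_B = ρ_𝒟 mod 𝔪ⁿ`,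
  open kernel, unramified outside `S`, and upper triangular at each `v ∣ p` in SOME frame
  `P_v ∈ GL₂(B)` lifting `noFrame v mod 𝔪ⁿ`, IS a deformation of type `𝒟` of `(B, π_B)` — these
  are exactly the outputs of the vanishing of the global obstruction
  (`exists_lift_of_globalObstruction_eq_zero`), of the local Borel obstructions
  (`exists_borelLift_of_localObstruction_eq_zero`) and of the secondary classes
  (`LiftingObstruction.conj_mem_parabolicGL_of_liftDiff_eq`);
* `exists_section_of_lift` — **then `q` has an `𝒪`-algebra section `R_𝒟/𝔪ⁿ → B`** provided
  `𝔪_Bⁿ = 0` (universality gives `φ : R_𝒟 → B`; `q ∘ φ` is the quotient map by uniqueness; `φ`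
  factors through `R_𝒟/𝔪ⁿ`).  With `B = 𝒪⟦T⟧/(J_u + 𝔪ⁿ)` this is the hypothesis `hob` of
  `NearlyOrdinaryPresentationProofs.nearlyOrdinaryPresentation_of_obstruction`.

Everything is proved; no named facts.

## References

* B. Mazur, *Deforming Galois representations*, in Galois groups over `ℚ`, MSRI Publ. 16
  (1989), §1.2 (universality), §1.6 Prop. 2. [cite: Mazur1989Deforming, §1.6 Prop. 2]
* G. Böckle, *Presentations of universal deformation rings*, LMS LNS 320 (2007), Thm. 2.4,
  Thm. 7.6. [cite: Bockle2007Presentations, Theorem 7.6]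
-/

noncomputable section

open scoped NumberField
open Field IsDedekindDomain IsLocalRing Topology

namespace Literature.NumberTheory.GaloisRepresentations

namespace NearlyOrdinaryDeformationRing

variable {F : Type} [Field F] [NumberField F] {p : ℕ} {𝒪 : Type} [CommRing 𝒪] {k : Type}
  [Field k] [Algebra 𝒪 k] {𝒟 : NearlyOrdinaryDatum F p 𝒪 k}
  (𝓡 : NearlyOrdinaryDeformationRing.{0} 𝒟)

/-! ## 1. Push-forward of `ρ_𝒟` along morphisms of `Ĉ_𝒪(k)` -/

/-- **`φ ∘ ρ_𝒟` is a deformation of type `𝒟`** for every `𝒪`-algebra map `φ : R_𝒟 → B` to an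
object of `Ĉ_𝒪(k)` (morphisms are local and compatible with augmentations; frames push forward).
[cite: Mazur1997Deformation, §8 and §20 Prop. 2] -/
theorem isDeformation_map (B : Deformation.CNLAlgebra 𝒪 k) (φ : 𝓡.R →ₐ[𝒪] B) :
    𝒟.IsDeformation B.residue
      ((Matrix.GeneralLinearGroup.map (φ : 𝓡.R →+* B)).comp 𝓡.ρ) := by
  have hk := 𝒟.residueMap_surjective
  have hπ : ((B.residue : B →ₐ[𝒪] k) : B →+* k).comp (φ : 𝓡.R →+* B) = (𝓡.π : 𝓡.R →+* k) :=
    RingHom.ext fun x => DFunLike.congr_fun (𝓡.augmentation_comp B.residue φ) x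
  refine ⟨⟨?_, ?_, fun v hv 𝔓 h𝔓 σ hσ => ?_⟩, fun v hv => ?_⟩
  · exact Deformation.IsAdicContinuous.comp_map hk (A := 𝓡.toCNL) (B := B) φ
      𝓡.isLift.isAdicContinuous
  · rw [← MonoidHom.comp_assoc, ← Matrix.GeneralLinearGroup.map_comp, hπ]
    exact 𝓡.isLift.residual_eq
  · rw [MonoidHom.comp_apply, 𝓡.isLift.unramified v hv 𝔓 h𝔓 σ hσ, map_one]
  · refine ⟨Matrix.GeneralLinearGroup.map (φ : 𝓡.R →+* B) (𝓡.noFrame v), ?_, fun σ => ?_⟩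
    · rw [← Matrix.GeneralLinearGroup.map_comp_apply, ← Matrix.GeneralLinearGroup.map_comp, hπ]
      exact 𝓡.noFrame_residual v hv
    · have h := 𝓡.noFrame_upper v hv σ
      have hmap : (Matrix.GeneralLinearGroup.map (φ : 𝓡.R →+* B) (𝓡.noFrame v))⁻¹ *
          ((Matrix.GeneralLinearGroup.map (φ : 𝓡.R →+* B)).comp 𝓡.ρ)
            (absGaloisRestrict F (v.adicCompletion F) σ) *
          Matrix.GeneralLinearGroup.map (φ : 𝓡.R →+* B) (𝓡.noFrame v) =
          Matrix.GeneralLinearGroup.map (φ : 𝓡.R →+* B)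
            ((𝓡.noFrame v)⁻¹ * 𝓡.ρ (absGaloisRestrict F (v.adicCompletion F) σ) * 𝓡.noFrame v) := by
        simp [map_mul, map_inv]
      rw [hmap]
      change φ (((𝓡.noFrame v)⁻¹ * 𝓡.ρ (absGaloisRestrict F (v.adicCompletion F) σ) *
        𝓡.noFrame v).val 1 0) = 0
      rw [h, map_zero]

/-- `𝔪_Rⁿ` is a proper ideal for `n ≠ 0`. [folklore] -/
theorem pow_maximalIdeal_ne_top {n : ℕ} (hn : n ≠ 0) : maximalIdeal 𝓡.R ^ n ≠ ⊤ :=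
  ((𝓡.toCNL).pow_maximalIdeal_ne_top n).resolve_right hn

/-- **`R_𝒟/𝔪ⁿ` as an object of `Ĉ_𝒪(k)`** (`n ≥ 1`; Artinian). [cite: Mazur1997Deformation, §2] -/
def truncCNL (n : ℕ) (hn : n ≠ 0) : Deformation.CNLAlgebra 𝒪 k :=
  (𝓡.toCNL).quotient (maximalIdeal 𝓡.R ^ n) (𝓡.pow_maximalIdeal_ne_top hn)

/-- The underlying type of `R_𝒟/𝔪ⁿ`. [folklore] -/
@[simp] theorem truncCNL_carrier (n : ℕ) (hn : n ≠ 0) :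
    ((𝓡.truncCNL n hn : Deformation.CNLAlgebra 𝒪 k) : Type) = (𝓡.R ⧸ maximalIdeal 𝓡.R ^ n) :=
  rfl

/-- The augmentation of `R_𝒟/𝔪ⁿ` on residue classes is `π`. [folklore] -/
theorem truncCNL_residue_mk (n : ℕ) (hn : n ≠ 0) (a : 𝓡.R) :
    (𝓡.truncCNL n hn).residue (Ideal.Quotient.mk (maximalIdeal 𝓡.R ^ n) a) = 𝓡.π a :=
  (𝓡.toCNL).quotient_residue_mk _ _ a

/-- The augmentation `π_n : R_𝒟/𝔪ⁿ → k` as a ring homomorphism. [folklore] -/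
def truncResidue (n : ℕ) (hn : n ≠ 0) : (𝓡.R ⧸ maximalIdeal 𝓡.R ^ n) →+* k :=
  ((𝓡.truncCNL n hn).residue : (𝓡.truncCNL n hn) →ₐ[𝒪] k).toRingHom

/-- `truncResidue` is the coercion of the augmentation of `truncCNL`. [folklore] -/
theorem truncResidue_eq (n : ℕ) (hn : n ≠ 0) :
    𝓡.truncResidue n hn = ((𝓡.truncCNL n hn).residue : (𝓡.truncCNL n hn) →+* k) :=
  rfl

/-- `π_n ∘ mk = π` as ring homomorphisms. [folklore] -/
theorem truncResidue_comp_mk (n : ℕ) (hn : n ≠ 0) :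
    (𝓡.truncResidue n hn).comp (Ideal.Quotient.mk (maximalIdeal 𝓡.R ^ n)) = (𝓡.π : 𝓡.R →+* k) :=
  RingHom.ext fun a => 𝓡.truncCNL_residue_mk n hn a

/-- **`ρ_𝒟 mod 𝔪ⁿ` is a deformation of type `𝒟`** of `(R_𝒟/𝔪ⁿ, π_n)`. [cite: Mazur1997Deformation, §8] -/
theorem isDeformation_modPow (n : ℕ) (hn : n ≠ 0) :
    𝒟.IsDeformation (𝓡.truncCNL n hn).residue (𝓡.modPow n) :=
  𝓡.isDeformation_map (𝓡.truncCNL n hn) (Ideal.Quotient.mkₐ 𝒪 (maximalIdeal 𝓡.R ^ n))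

/-- **Uniqueness half of universality, mod `𝔪ⁿ`**: an `𝒪`-algebra map `ψ : R_𝒟 → R_𝒟/𝔪ⁿ`
with `ψ ∘ ρ_𝒟` strictly equivalent to `ρ_𝒟 mod 𝔪ⁿ` is the quotient map.
[cite: Mazur1989Deforming, §1.2] -/
theorem eq_mkₐ_of_isStrictEquiv {n : ℕ} (hn : n ≠ 0) (ψ : 𝓡.R →ₐ[𝒪] 𝓡.R ⧸ maximalIdeal 𝓡.R ^ n)
    (h : Deformation.IsStrictEquiv (𝓡.truncResidue n hn)
      ((Matrix.GeneralLinearGroup.map (ψ : 𝓡.R →+* 𝓡.R ⧸ maximalIdeal 𝓡.R ^ n)).comp 𝓡.ρ)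
      (𝓡.modPow n)) :
    ψ = Ideal.Quotient.mkₐ 𝒪 (maximalIdeal 𝓡.R ^ n) := by
  have hu := 𝓡.universal (𝓡.truncCNL n hn) (𝓡.truncCNL n hn).residue
    (𝓡.truncCNL n hn).residue_surjective (𝓡.modPow n) (𝓡.isDeformation_modPow n hn)
  exact hu.unique h (Deformation.IsStrictEquiv.refl _ _)

/-! ## 2. From a lift of `ρ_𝒟 mod 𝔪ⁿ` to a deformation of type `𝒟` -/

section Lift

variable {n : ℕ} (hn : n ≠ 0) (B : Deformation.CNLAlgebra 𝒪 k)
  (q : B →ₐ[𝒪] 𝓡.R ⧸ maximalIdeal 𝓡.R ^ n)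
  (ρB : absoluteGaloisGroup F →* GL (Fin 2) B)
  (hρB : ∀ σ, Matrix.GeneralLinearGroup.map (q : B →+* 𝓡.R ⧸ maximalIdeal 𝓡.R ^ n) (ρB σ) =
    𝓡.modPow n σ)
  (hopen : IsOpen ((ρB.ker : Subgroup (absoluteGaloisGroup F)) : Set (absoluteGaloisGroup F)))
  (hur : ∀ v ∉ 𝒟.S, Deformation.IsUnramifiedAt v ρB)
  (hNO : ∀ v : HeightOneSpectrum (𝓞 F), (p : 𝓞 F) ∈ v.asIdeal →
    ∃ P : GL (Fin 2) B,
      Matrix.GeneralLinearGroup.map (q : B →+* 𝓡.R ⧸ maximalIdeal 𝓡.R ^ n) P =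
        Matrix.GeneralLinearGroup.map (Ideal.Quotient.mk (maximalIdeal 𝓡.R ^ n)) (𝓡.noFrame v) ∧
      ∀ σ, (P⁻¹ * ρB (absGaloisRestrict F (v.adicCompletion F) σ) * P).val 1 0 = 0)

include hn in
/-- The augmentation of `B` factors through `q`: `π_B = π_n ∘ q` (augmentations are unique).
[cite: Mazur1997Deformation, §2] -/
theorem residue_eq_comp : (B.residue : B →+* k) =
    (𝓡.truncResidue n hn).comp (q : B →+* 𝓡.R ⧸ maximalIdeal 𝓡.R ^ n) := by
  have h := 𝒟.algHom_residue_unique B.residue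
    (((𝓡.truncCNL n hn).residue : (𝓡.truncCNL n hn) →ₐ[𝒪] k).comp q)
  exact congrArg (fun f : B →ₐ[𝒪] k => (f : B →+* k)) h

include hn hρB hopen hur hNO in
/-- **A lift of `ρ_𝒟 mod 𝔪ⁿ` with open kernel, unramified outside `S` and upper triangular at
each `v ∣ p` in a frame lifting `noFrame v mod 𝔪ⁿ` is a deformation of type `𝒟`.**
[cite: Mazur1989Deforming, §1.6 Prop. 2] [cite: Bockle2007Presentations, Theorem 7.6] -/
theorem isDeformation_of_lift : 𝒟.IsDeformation B.residue ρB := by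
  have hres := 𝓡.residue_eq_comp hn B q
  refine ⟨⟨fun m => ?_, ?_, hur⟩, fun v hv => ?_⟩
  · refine Subgroup.isOpen_mono ?_ hopen
    intro σ hσ
    rw [MonoidHom.mem_ker] at hσ ⊢
    rw [MonoidHom.comp_apply, hσ, map_one]
  · refine MonoidHom.ext fun σ => ?_
    have h1 := DFunLike.congr_fun 𝓡.isLift.residual_eq σ
    rw [MonoidHom.comp_apply] at h1 ⊢
    rw [hres, Matrix.GeneralLinearGroup.map_comp, MonoidHom.comp_apply, hρB, modPow_apply,
      ← Matrix.GeneralLinearGroup.map_comp_apply, ← Matrix.GeneralLinearGroup.map_comp,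
      truncResidue_comp_mk]
    exact h1
  · obtain ⟨P, hP, hup⟩ := hNO v hv
    refine ⟨P, ?_, hup⟩
    rw [hres, Matrix.GeneralLinearGroup.map_comp, MonoidHom.comp_apply, hP,
      ← Matrix.GeneralLinearGroup.map_comp_apply, ← Matrix.GeneralLinearGroup.map_comp,
      truncResidue_comp_mk]
    exact 𝓡.noFrame_residual v hv

/-! ## 3. The section -/

include hn hρB hopen hur hNO in
/-- **Universality turns the lift into a section.**  Under the hypotheses of
`isDeformation_of_lift`, if moreover `𝔪_Bⁿ = 0`, then `q : B → R_𝒟/𝔪ⁿ` has an `𝒪`-algebra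
section.  (Universality of `𝓡` gives `φ : R_𝒟 → B` with `φ ∘ ρ_𝒟 ∼ ρ_B`; then `q ∘ φ ∘ ρ_𝒟 ∼
ρ_𝒟 mod 𝔪ⁿ`, so `q ∘ φ` is the quotient map by uniqueness, and `φ` factors through `R_𝒟/𝔪ⁿ`
because it is local.) [cite: Mazur1989Deforming, §1.6 Prop. 2] [cite: Bockle2007Presentations, Theorem 7.6] -/
theorem exists_section_of_lift (hmB : maximalIdeal B ^ n = ⊥) :
    ∃ s : (𝓡.R ⧸ maximalIdeal 𝓡.R ^ n) →ₐ[𝒪] B, q.comp s = AlgHom.id 𝒪 _ := by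
  have hk := 𝒟.residueMap_surjective
  obtain ⟨φ, hφ, -⟩ := 𝓡.universal B B.residue B.residue_surjective ρB
    (𝓡.isDeformation_of_lift hn B q ρB hρB hopen hur hNO)
  -- `q ∘ φ` is the quotient map
  have hqφ : q.comp φ = Ideal.Quotient.mkₐ 𝒪 (maximalIdeal 𝓡.R ^ n) := by
    refine 𝓡.eq_mkₐ_of_isStrictEquiv hn (q.comp φ) ?_
    obtain ⟨P, hP1, hP2⟩ := hφ
    refine ⟨Matrix.GeneralLinearGroup.map (q : B →+* 𝓡.R ⧸ maximalIdeal 𝓡.R ^ n) P, ?_,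
      fun γ => ?_⟩
    · rw [← Matrix.GeneralLinearGroup.map_comp_apply, ← Matrix.GeneralLinearGroup.map_comp,
        ← 𝓡.residue_eq_comp hn B q, hP1]
    · rw [← hρB γ, hP2 γ, map_mul, map_mul, map_inv, MonoidHom.comp_apply, MonoidHom.comp_apply,
        ← Matrix.GeneralLinearGroup.map_comp_apply, ← Matrix.GeneralLinearGroup.map_comp]
      rfl
  -- `φ` kills `𝔪_Rⁿ`
  have h0 : ∀ a : 𝓡.R, a ∈ maximalIdeal 𝓡.R ^ n → φ a = 0 := by
    intro a ha
    have hle := Deformation.CNLAlgebra.map_pow_maximalIdeal_le hk (A := 𝓡.toCNL) (B := B) φ n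
    have hmem : φ a ∈ (maximalIdeal (𝓡.toCNL : Type) ^ n).map (φ : 𝓡.R →+* B) :=
      Ideal.mem_map_of_mem _ ha
    have h' := hle hmem
    rw [hmB, Ideal.mem_bot] at h'
    exact h'
  refine ⟨Ideal.Quotient.liftₐ (maximalIdeal 𝓡.R ^ n) φ h0, ?_⟩
  refine Ideal.Quotient.algHom_ext 𝒪 ?_
  rw [AlgHom.comp_assoc, Ideal.Quotient.liftₐ_comp, hqφ, AlgHom.id_comp]

end Lift

end NearlyOrdinaryDeformationRing

end Literature.NumberTheory.GaloisRepresentations
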